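import Summits.Ventures.PercRepro.S1CFNullity

/-!
# PercRepro — A SET COVERED BY PARALLEL PAIRS HAS RANK AT MOST HALF ITS SIZE (p1, gen 37)

The third generic tool of the ν = 4 caps. In a loopless matroid, if every point `y` of `Y` has a PARTNER `z ∈ Y`
(`z ≠ y`, `{y, z}` dependent — `z` parallel to `y`), then **`two_mul_eRk_toNat_le_ncard_of_partner`**:
`2 · rk Y ≤ |Y|` — `Y` is a union of parallel classes of size `≥ 2`, each of rank `1`. Strong induction on `|Y|`:
remove the whole class `K = Y ∩ cl {y}` of a point (`|K| ≥ 2`, `rk K ≤ 1`); partners of the points outside `K` stay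
outside `K` (`{y', z'}` dependent and `z' ∈ cl {y}` put `y'` in `cl {y}`). Also the small parallel facts
**`mem_closure_singleton_of_dep_pair`** (`{u, v}` dependent, `u` a non-loop ⇒ `v ∈ cl {u}`) and
**`closure_singleton_eq_of_mem_closure_singleton`** (a non-loop inside `cl {x}` has the same closure).
Nothing about any cell is claimed. Axioms: standard.
-/

open scoped Matroid

namespace PercRepro

namespace S1CF

open Set

variable {α : Type}

/-- A non-loop of the ground set gives an independent singleton. -/
theorem indep_singleton_of_not_isLoop (M : Matroid α) {u : α} (hu : u ∈ M.E) (hL : ¬ M.IsLoop u) :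
    M.Indep {u} := by
  rw [Matroid.indep_singleton]
  exact (Matroid.not_isLoop_iff hu).1 hL

/-- `{u, v}` dependent with `u` a non-loop puts `v` in `cl {u}`. -/
theorem mem_closure_singleton_of_dep_pair (M : Matroid α) {u v : α} (hu : u ∈ M.E) (hL : ¬ M.IsLoop u)
    (hdep : M.Dep {u, v}) : v ∈ M.closure {u} := by
  have hI : M.Indep {u} := indep_singleton_of_not_isLoop M hu hL
  have h : M.Dep (insert v {u}) := by
    have : insert v {u} = ({u, v} : Set α) := Set.pair_comm v u
    rw [this]; exact hdep
  rw [hI.insert_dep_iff] at h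
  exact h.1

/-- A non-loop `u ∈ cl {x}` of a non-loop `x` has `cl {u} = cl {x}`. -/
theorem closure_singleton_eq_of_mem_closure_singleton (M : Matroid α) {x u : α} (hx : x ∈ M.E)
    (hLx : ¬ M.IsLoop x) (hu : u ∈ M.closure {x}) (hLu : ¬ M.IsLoop u) : M.closure {u} = M.closure {x} := by
  have huE : u ∈ M.E := M.closure_subset_ground _ hu
  apply le_antisymm
  · exact M.closure_subset_closure_of_subset_closure (Set.singleton_subset_iff.2 hu)
  · apply M.closure_subset_closure_of_subset_closure
    rw [Set.singleton_subset_iff]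
    by_cases hux : u = x
    · subst hux; exact M.mem_closure_self u huE
    · have hI : M.Indep {x} := indep_singleton_of_not_isLoop M hx hLx
      have hdep : M.Dep (insert u {x}) := by
        rw [hI.insert_dep_iff]
        exact ⟨hu, fun h => hux (Set.mem_singleton_iff.1 h)⟩
      exact mem_closure_singleton_of_dep_pair M huE hLu hdep

/-- **A set every point of which has a parallel partner inside it has rank at most half its size**:
`2 · rk Y ≤ |Y|` (loopless matroid). -/
theorem two_mul_eRk_toNat_le_ncard_of_partner (M : Matroid α) [M.Finite] (hL : ∀ e ∈ M.E, ¬ M.IsLoop e) :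
    ∀ (n : ℕ) (Y : Set α), Y ⊆ M.E → Y.ncard = n → (∀ y ∈ Y, ∃ z ∈ Y, z ≠ y ∧ M.Dep {y, z}) →
      2 * (M.eRk Y).toNat ≤ Y.ncard := by
  intro n
  induction n using Nat.strong_induction_on with
  | _ n ih =>
    intro Y hY hYn hpart
    have hYfin : Y.Finite := M.ground_finite.subset hY
    rcases Y.eq_empty_or_nonempty with hYe | ⟨y, hyY⟩
    · subst hYe; simp
    have hyE : y ∈ M.E := hY hyY
    set K : Set α := Y ∩ M.closure {y} with hKdef
    set Y' : Set α := Y \ K with hY'def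
    have hKY : K ⊆ Y := inter_subset_left
    have hyK : y ∈ K := ⟨hyY, M.mem_closure_self y hyE⟩
    obtain ⟨z, hzY, hzy, hdep⟩ := hpart y hyY
    have hzK : z ∈ K := ⟨hzY, mem_closure_singleton_of_dep_pair M hyE (hL y hyE) hdep⟩
    have hKfin : K.Finite := hYfin.subset hKY
    have hK2 : 2 ≤ K.ncard := by
      have : ({y, z} : Set α) ⊆ K := by
        intro w hw
        rcases hw with rfl | rfl
        · exact hyK
        · exact hzK
      have h2 : ({y, z} : Set α).ncard = 2 := Set.ncard_pair (Ne.symm hzy)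
      rw [← h2]
      exact Set.ncard_le_ncard this hKfin
    -- `Y'` still satisfies the partner property
    have hpart' : ∀ y' ∈ Y', ∃ z' ∈ Y', z' ≠ y' ∧ M.Dep {y', z'} := by
      intro y' hy'
      obtain ⟨z', hz'Y, hz'y', hdep'⟩ := hpart y' hy'.1
      refine ⟨z', ⟨hz'Y, ?_⟩, hz'y', hdep'⟩
      intro hz'K
      apply hy'.2
      refine ⟨hy'.1, ?_⟩
      have hz'E : z' ∈ M.E := hY hz'Y
      have h1 : y' ∈ M.closure {z'} :=
        mem_closure_singleton_of_dep_pair M hz'E (hL z' hz'E) (by rwa [Set.pair_comm])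
      have h2 : M.closure {z'} = M.closure {y} :=
        closure_singleton_eq_of_mem_closure_singleton M hyE (hL y hyE) hz'K.2 (hL z' hz'E)
      rw [← h2]; exact h1
    have hY'Y : Y' ⊆ Y := sdiff_subset
    have hY'fin : Y'.Finite := hYfin.subset hY'Y
    have hcard : Y'.ncard + K.ncard = Y.ncard := Set.ncard_sdiff_add_ncard_of_subset hKY hYfin
    have hlt : Y'.ncard < n := by omega
    have ih' := ih _ hlt Y' (hY'Y.trans hY) rfl hpart'
    -- rank step
    have hrkK : M.eRk K ≤ 1 := eRk_le_one_of_subset_closure_singleton M inter_subset_right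
    have hrk : M.eRk Y ≤ M.eRk Y' + M.eRk K := by
      have : Y = Y' ∪ K := by rw [hY'def, Set.sdiff_union_of_subset hKY]
      rw [this]; exact M.eRk_union_le_eRk_add_eRk Y' K
    have hrk' : M.eRk Y ≤ M.eRk Y' + 1 := hrk.trans (by gcongr)
    rw [← S1.coe_toNat_eRk M hY, ← S1.coe_toNat_eRk M (hY'Y.trans hY)] at hrk'
    have hrkN : (M.eRk Y).toNat ≤ (M.eRk Y').toNat + 1 := by exact_mod_cast hrk'
    omega

end S1CF

end PercRepro
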